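/-
Copyright: statement-level skeleton of a published paper (lit-balaban cell, Phase-2 proof seat p19, gen 5). No claims beyond
what the kernel checks below.
-/
import Mathlib
import Literature.MathematicalPhysics.QuantumFieldTheory.Balaban1983to89.B3IBPZeroBox

/-!
# B3 — T. Bałaban, *(Higgs)₂,₃ quantum fields in a finite volume. III. Renormalization*, CMP **88** (1983) 411–445
[Balaban1983Higgs3] — the VERTEX SIDE of the zero-field box class: vertex functions built from field legs and a localization
function satisfy the vertex data `VertexDataIBP` of `B3IBPZeroBox` (the bound of a vertex by the product of the norms of its
legs, face vanishing, and the differentiated vertex bound after the integration by parts (2.8), by the lattice product rule)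

statement-level skeleton of published theorems with citation tags; proofs where landed; nothing here is a claim about
the Yang–Mills mass gap

PDF held: `paper:balaban1983-higgs-2-3-quantum-fields-finite-volume` (journal page = PDF page + 410); pp. 425–426 [PDF 15–16]
read on the materialised text (`lit read … --pages 15-16`).

Part of the Phase-2 work on SKELETON rows **B3.Prop2.1 / B3.Eq2.8-2.9 / B3.Eq2.13-2.14 / B3.Def@420** (unit `lit-balaban-p19` gen 5, HOME
`run/shared/lean/pub/lit-balaban/`), file 6: the vertex fields of the IBP-ready class `IBPAmp₁` (`B3AmpIBPSingle`) for the
zero-field box class (`B3IBPZeroBox.VertexDataIBP`: `u_le`, `u_face`, `du_le`) DERIVED from primitive leg data.  Own namespace;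
definitions with bodies and theorems; nothing existing is modified.

WHAT IS REPRODUCED.  p. 426 [PDF 16]: *"We estimate it taking absolute values of all factors. The external fields are estimated
further by the Hölder norms … Finally in vertices we apply the inequalities |g_k| ≤ 1, …"*, giving the vertex factors
`(e(L^kε))^{d_v}(λ(L^kε))^{d_s} Π N^Φ_v Π N^A_v` of (2.13)–(2.14); and p. 425 [PDF 15], (2.8)–(2.9): after the integration by parts at
a vertex of (2.4) the lattice derivative falls on the remaining factors of the vertex — the localization function `g`, the vector
field `A′` and the other scalar leg — term by term (the three terms of (2.8) = the lattice product rule), each new vertex being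
bounded by the same norms (*"the degrees of the vertices on the right side of (2.8) or (2.9) are bigger or equal to the degree of
the left side"*).  KERNEL-CHECKED HERE: for a vertex function `u_v(x) = e^{d_v}λ^{d_s}η^{e_v}·g_v(x)·Π_iΦ_i(x)·Π_jA_j(x)` whose legs obey
`|Φ_i| ≤ N_i`, `|∂^{η,−}_μΦ_i| ≤ N_i` (sup and unit-scale difference bounds, every direction), likewise `A_j`, and `|g_v| ≤ 1`,
`|∂^{η,−}_μ g_v| ≤ 1`: the vertex bound `u_le` with `N^Φ_v = ΠN_i`, `N^A_v = ΠN_j` (`abs_uOf_le`); the LATTICE PRODUCT RULE bound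
`η^{-1}|u_v(x) − u_v(x − ηe_μ)| ≤ (1 + p_v + q_v)·e^{d_v}λ^{d_s}η^{e_v}N^Φ_vN^A_v` (`mul_abs_prod_sub_prod_le`, `duOf_le`); face vanishing
of `u_v` from that of `g_v` (`faceVanishing_uOf`); whence `vertexDataOfLegs` with `c_D = 1 + max_v(p_v + q_v)`, to which
`B3IBPZeroBox.abs_Etot_iboxAmp_le` / `iboxAmp` apply verbatim; a non-zero face-vanishing localization function with the two
bounds (the tent across `□(v)`, `tent`, `tent_faceVanishing`, `abs_tent_le`, `dtent_le` — p. 420: localizations by *"a smooth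
partition of unity with supports in cubes"*), so the data are inhabited non-trivially (`vertexLegsTent`, `vertexDataTent`); and,
for external legs assigned to every graph of the class with boundedly many legs per vertex (`LegField`, `1 + p_max ≤ C_D`), the
datum `datumWithLegs` of the family `famZB` and **(1.33) for it from `prop21_zeroBox`** (`ineq133At_withLegs`): Proposition 2.1
with the (2.4) exception for the zero-field box class with vertex functions of the printed product form, line kernels AND vertex
bounds derived.  Scope as in `B3IBPZeroBox` (A = B̃ = 0, Ω = □); of the norm (1.32) only the sup and difference terms are used
(no Hölder quotient); the unit-scale difference bound of `g` is our normalization of the smoothness of `g_k` / of the partition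
of unity.
-/

open Finset

namespace Literature.MathematicalPhysics.QuantumFieldTheory.Balaban1983to89.B3IBPZeroBoxVertices

open Literature.MathematicalPhysics.QuantumFieldTheory.Balaban1983to89.B3Ineq215
open Literature.MathematicalPhysics.QuantumFieldTheory.Balaban1983to89.B3Ineq213
open Literature.MathematicalPhysics.QuantumFieldTheory.Balaban1983to89.B3IBPZeroBox

noncomputable section

variable {d : ℕ}

/-! ## §1 The lattice product rule, as an estimate -/

/-- **The lattice product rule (the three terms of (2.8)) as an estimate**: if `|a_i|, |b_i| ≤ N_i` and `s|a_i − b_i| ≤ κ_i N_i`,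
then `s|Π a_i − Π b_i| ≤ (Σ κ_i) Π N_i`. [cite: Balaban1983Higgs3, (2.8) p.425] -/
theorem mul_abs_prod_sub_prod_le {n : ℕ} (s : ℝ) (hs : 0 ≤ s) (a b N κ : Fin n → ℝ) (hκ : ∀ i, 0 ≤ κ i)
    (ha : ∀ i, |a i| ≤ N i) (hb : ∀ i, |b i| ≤ N i) (hab : ∀ i, s * |a i - b i| ≤ κ i * N i) :
    s * |∏ i, a i - ∏ i, b i| ≤ (∑ i, κ i) * ∏ i, N i := by
  induction n with
  | zero => simp
  | succ n ih =>
    have hN : ∀ i, 0 ≤ N i := fun i => (abs_nonneg _).trans (ha i)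
    have hA : |∏ i : Fin n, a i.succ| ≤ ∏ i : Fin n, N i.succ := by
      rw [Finset.abs_prod]; exact prod_le_prod (fun i _ => abs_nonneg _) fun i _ => ha _
    have hih := ih (fun i => a i.succ) (fun i => b i.succ) (fun i => N i.succ) (fun i => κ i.succ) (fun i => hκ _)
      (fun i => ha _) (fun i => hb _) fun i => hab _
    have hP : 0 ≤ ∏ i : Fin n, N i.succ := prod_nonneg fun i _ => hN _
    have hK : 0 ≤ ∑ i : Fin n, κ i.succ := sum_nonneg fun i _ => hκ _
    rw [Fin.prod_univ_succ, Fin.prod_univ_succ, Fin.prod_univ_succ, Fin.sum_univ_succ]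
    have hsplit : a 0 * ∏ i : Fin n, a i.succ - b 0 * ∏ i : Fin n, b i.succ
        = (a 0 - b 0) * ∏ i : Fin n, a i.succ + b 0 * (∏ i : Fin n, a i.succ - ∏ i : Fin n, b i.succ) := by ring
    rw [hsplit]
    have h1 : s * |(a 0 - b 0) * ∏ i : Fin n, a i.succ| ≤ κ 0 * N 0 * ∏ i : Fin n, N i.succ := by
      rw [abs_mul, ← mul_assoc]
      exact mul_le_mul (hab 0) hA (abs_nonneg _) (mul_nonneg (hκ 0) (hN 0))
    have h2 : s * |b 0 * (∏ i : Fin n, a i.succ - ∏ i : Fin n, b i.succ)|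
        ≤ N 0 * ((∑ i : Fin n, κ i.succ) * ∏ i : Fin n, N i.succ) := by
      rw [abs_mul, mul_left_comm]
      exact mul_le_mul (hb 0) hih (mul_nonneg hs (abs_nonneg _)) (hN 0)
    calc s * |(a 0 - b 0) * ∏ i : Fin n, a i.succ + b 0 * (∏ i : Fin n, a i.succ - ∏ i : Fin n, b i.succ)|
        ≤ s * |(a 0 - b 0) * ∏ i : Fin n, a i.succ| + s * |b 0 * (∏ i : Fin n, a i.succ - ∏ i : Fin n, b i.succ)| := by
          rw [← mul_add]; exact mul_le_mul_of_nonneg_left (abs_add_le _ _) hs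
      _ ≤ κ 0 * N 0 * ∏ i : Fin n, N i.succ + N 0 * ((∑ i : Fin n, κ i.succ) * ∏ i : Fin n, N i.succ) := add_le_add h1 h2
      _ = (κ 0 + ∑ i : Fin n, κ i.succ) * (N 0 * ∏ i : Fin n, N i.succ) := by ring

/-! ## §2 Field legs at a vertex -/

/-- **Field legs at a vertex**: `p` lattice functions (external fields restricted to the lattice, after `k` steps) with the
sup bounds `|f_i| ≤ N_i` and the unit-scale difference bounds `η^{-1}|f_i(x) − f_i(x − ηe_μ)| ≤ N_i` in every direction (the first two
terms of the norm (1.32)). [cite: Balaban1983Higgs3, (1.32) p.420, (2.13) p.426] -/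
structure Legs (d p : ℕ) (s : ℝ) where
  /-- the leg functions -/
  f : Fin p → (Fin (d + 1) → ℕ) → ℝ
  /-- their norms -/
  N : Fin p → ℝ
  f_le : ∀ i x, |f i x| ≤ N i
  df_le : ∀ i (μ : Fin (d + 1)) x, s * |f i x - f i (bsh μ x)| ≤ N i

namespace Legs

variable {p : ℕ} {s : ℝ} (Λ : Legs d p s)

/-- The norms are non-negative. [cite: Balaban1983Higgs3, (1.32) p.420] -/
theorem N_nonneg (i : Fin p) : 0 ≤ Λ.N i := (abs_nonneg _).trans (Λ.f_le i fun _ => 0)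

/-- The product of the legs. [cite: Balaban1983Higgs3, (2.13) p.426] -/
def prodF (x : Fin (d + 1) → ℕ) : ℝ := ∏ i, Λ.f i x

/-- The product of the norms `Π N_i` (= `N^Φ_v` or `N^A_v`). [cite: Balaban1983Higgs3, (2.13) p.426] -/
def prodN : ℝ := ∏ i, Λ.N i

/-- `0 ≤ Π N_i`. [cite: Balaban1983Higgs3, (2.13) p.426] -/
theorem prodN_nonneg : 0 ≤ Λ.prodN := prod_nonneg fun i _ => Λ.N_nonneg i

/-- **"taking absolute values of all factors"**: `|Π f_i(x)| ≤ Π N_i`. [cite: Balaban1983Higgs3, (2.13) p.426] -/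
theorem abs_prodF_le (x : Fin (d + 1) → ℕ) : |Λ.prodF x| ≤ Λ.prodN := by
  unfold prodF prodN
  rw [Finset.abs_prod]
  exact prod_le_prod (fun i _ => abs_nonneg _) fun i _ => Λ.f_le i x

/-- The product rule for the legs: `η^{-1}|Π f_i(x) − Π f_i(x − ηe_μ)| ≤ p·Π N_i`. [cite: Balaban1983Higgs3, (2.8) p.425] -/
theorem dprodF_le (hs : 0 ≤ s) (μ : Fin (d + 1)) (x : Fin (d + 1) → ℕ) :
    s * |Λ.prodF x - Λ.prodF (bsh μ x)| ≤ p * Λ.prodN := by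
  have h := mul_abs_prod_sub_prod_le s hs (fun i => Λ.f i x) (fun i => Λ.f i (bsh μ x)) Λ.N (fun _ => 1)
    (fun _ => zero_le_one) (fun i => Λ.f_le i x) (fun i => Λ.f_le i _) (fun i => by rw [one_mul]; exact Λ.df_le i μ x)
  simpa [prodF, prodN] using h

end Legs

/-! ## §3 The vertex function of legs and a localization function -/

/-- **The data of a vertex**: `p` scalar legs `Φ_i`, `q` vector legs `A_j`, and a localization function `g` (the coupling cut-off
`g_k` of (1.29) times the partition-of-unity function of p. 420) with `|g| ≤ 1` (p. 426: *"in vertices we apply the inequalities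
|g_k| ≤ 1"*) and the unit-scale difference bound `η^{-1}|g(x) − g(x − ηe_μ)| ≤ 1` (normalization of its smoothness).
[cite: Balaban1983Higgs3, (2.13) p.426, (1.29) p.419, p.420] -/
structure VertexLegs (d : ℕ) (s : ℝ) where
  /-- number of scalar legs -/
  p : ℕ
  /-- number of vector legs -/
  q : ℕ
  /-- the scalar legs -/
  Φ : Legs d p s
  /-- the vector legs -/
  A : Legs d q s
  /-- the localization function -/
  g : (Fin (d + 1) → ℕ) → ℝ
  g_le : ∀ x, |g x| ≤ 1
  dg_le : ∀ (μ : Fin (d + 1)) x, s * |g x - g (bsh μ x)| ≤ 1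

namespace VertexLegs

variable {s : ℝ} (W : VertexLegs d s)

/-- The field part `g(x)·ΠΦ_i(x)·ΠA_j(x)` of the vertex function. [cite: Balaban1983Higgs3, (2.13) p.426] -/
def core (x : Fin (d + 1) → ℕ) : ℝ := W.g x * (W.Φ.prodF x * W.A.prodF x)

/-- `|g ΠΦ ΠA| ≤ N^Φ N^A`. [cite: Balaban1983Higgs3, (2.13) p.426] -/
theorem abs_core_le (x : Fin (d + 1) → ℕ) : |W.core x| ≤ W.Φ.prodN * W.A.prodN := by
  unfold core
  rw [abs_mul, abs_mul]
  calc |W.g x| * (|W.Φ.prodF x| * |W.A.prodF x|) ≤ 1 * (W.Φ.prodN * W.A.prodN) :=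
        mul_le_mul (W.g_le x) (mul_le_mul (W.Φ.abs_prodF_le x) (W.A.abs_prodF_le x) (abs_nonneg _) W.Φ.prodN_nonneg)
          (mul_nonneg (abs_nonneg _) (abs_nonneg _)) zero_le_one
    _ = W.Φ.prodN * W.A.prodN := one_mul _

/-- **The product rule at a vertex**: `η^{-1}|core(x) − core(x − ηe_μ)| ≤ (1 + p + q)·N^Φ N^A` — the derivative falls on `g`, on one
of the `Φ_i`, or on one of the `A_j` (the three terms of (2.8)). [cite: Balaban1983Higgs3, (2.8) p.425] -/
theorem dcore_le (hs : 0 ≤ s) (μ : Fin (d + 1)) (x : Fin (d + 1) → ℕ) :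
    s * |W.core x - W.core (bsh μ x)| ≤ (1 + W.p + W.q) * (W.Φ.prodN * W.A.prodN) := by
  have h := mul_abs_prod_sub_prod_le s hs ![W.g x, W.Φ.prodF x, W.A.prodF x]
    ![W.g (bsh μ x), W.Φ.prodF (bsh μ x), W.A.prodF (bsh μ x)] ![1, W.Φ.prodN, W.A.prodN] ![1, W.p, W.q]
    (fun i => by fin_cases i <;> simp)
    (fun i => by
      fin_cases i
      · simpa using W.g_le x
      · simpa using W.Φ.abs_prodF_le x
      · simpa using W.A.abs_prodF_le x)
    (fun i => by
      fin_cases i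
      · simpa using W.g_le (bsh μ x)
      · simpa using W.Φ.abs_prodF_le (bsh μ x)
      · simpa using W.A.abs_prodF_le (bsh μ x))
    (fun i => by
      fin_cases i
      · simpa using W.dg_le μ x
      · simpa using W.Φ.dprodF_le hs μ x
      · simpa using W.A.dprodF_le hs μ x)
  simp only [Fin.prod_univ_succ, Fin.prod_univ_zero, Fin.sum_univ_succ, Fin.sum_univ_zero, Matrix.cons_val_zero,
    Matrix.cons_val_succ, mul_one, one_mul, add_zero] at h
  rw [← add_assoc] at h
  exact h

/-- Face vanishing of `g` gives face vanishing of the field part. [cite: Balaban1983Higgs3, (2.8) p.425] -/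
theorem faceVanishing_core {L : ℕ} {C : Cube (d + 1)} {μ : Fin (d + 1)} (h : FaceVanishing L C μ W.g) :
    FaceVanishing L C μ W.core := fun x hx => by
  unfold core; rw [h x hx, zero_mul]

end VertexLegs

/-! ## §4 The vertex datum of a graph from legs -/

section OfLegs

variable {V : Type} [Fintype V] [DecidableEq V] {m : ℕ}

/-- The mesh factor `s = η^{-1} = L^k`. [cite: Balaban1983Higgs3, (2.13) p.426] -/
def mesh (ℓ k : ℕ) : ℝ := (((ℓ + 1 : ℕ) : ℝ)) ^ k

/-- `0 < L^k`. [cite: Balaban1983Higgs3, (2.13) p.426] -/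
theorem mesh_pos (ℓ k : ℕ) : 0 < mesh ℓ k := by unfold mesh; positivity

/-- **The vertex function of legs**: `u_v(x) = e^{d_v(v)}λ^{d_s(v)}η^{e_v}·g_v(x)ΠΦ_i(x)ΠA_j(x)`. [cite: Balaban1983Higgs3, (2.13) p.426] -/
def uOf (Γ : SDGraph V m d) (ℓ k : ℕ) (eRun lamRun : ℝ) (dv ds : V → ℕ) (W : V → VertexLegs d (mesh ℓ k)) (v : V)
    (x : Fin (d + 1) → ℕ) : ℝ :=
  eRun ^ dv v * lamRun ^ ds v * ((mesh ℓ k)⁻¹) ^ (Γ.etaPow v : ℝ) * (W v).core x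

variable (Γ : SDGraph V m d) (ℓ k : ℕ) {eRun lamRun : ℝ} (he : 0 ≤ eRun) (hl : 0 ≤ lamRun) (dv ds : V → ℕ)
  (W : V → VertexLegs d (mesh ℓ k))

include he hl in
/-- The coupling prefactor is non-negative. [cite: Balaban1983Higgs3, (2.13) p.426] -/
theorem coef_nonneg (v : V) : 0 ≤ eRun ^ dv v * lamRun ^ ds v * ((mesh ℓ k)⁻¹) ^ (Γ.etaPow v : ℝ) :=
  mul_nonneg (mul_nonneg (pow_nonneg he _) (pow_nonneg hl _)) (Real.rpow_nonneg (inv_nonneg.2 (mesh_pos ℓ k).le) _)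

include he hl in
/-- **The vertex bound** `|u_v(x)| ≤ e^{d_v}λ^{d_s}N^Φ_vN^A_vη^{e_v}`. [cite: Balaban1983Higgs3, (2.13) p.426] -/
theorem abs_uOf_le (v : V) (x : Fin (d + 1) → ℕ) :
    |uOf Γ ℓ k eRun lamRun dv ds W v x|
      ≤ eRun ^ dv v * lamRun ^ ds v * (W v).Φ.prodN * (W v).A.prodN * ((mesh ℓ k)⁻¹) ^ (Γ.etaPow v : ℝ) := by
  unfold uOf
  rw [abs_mul, abs_of_nonneg (coef_nonneg Γ ℓ k he hl dv ds v)]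
  calc eRun ^ dv v * lamRun ^ ds v * ((mesh ℓ k)⁻¹) ^ (Γ.etaPow v : ℝ) * |(W v).core x|
      ≤ eRun ^ dv v * lamRun ^ ds v * ((mesh ℓ k)⁻¹) ^ (Γ.etaPow v : ℝ) * ((W v).Φ.prodN * (W v).A.prodN) :=
        mul_le_mul_of_nonneg_left ((W v).abs_core_le x) (coef_nonneg Γ ℓ k he hl dv ds v)
    _ = _ := by ring

include he hl in
/-- **The differentiated vertex bound** `η^{-1}|u_v(x) − u_v(x − ηe_μ)| ≤ (1 + p_v + q_v)·e^{d_v}λ^{d_s}N^Φ_vN^A_vη^{e_v}`, by the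
product rule. [cite: Balaban1983Higgs3, (2.8) p.425, (2.13) p.426] -/
theorem duOf_le (v : V) (μ : Fin (d + 1)) (x : Fin (d + 1) → ℕ) :
    |bdiffQ (mesh ℓ k) μ (uOf Γ ℓ k eRun lamRun dv ds W v) x|
      ≤ (1 + (W v).p + (W v).q) * (eRun ^ dv v * lamRun ^ ds v * (W v).Φ.prodN * (W v).A.prodN
          * ((mesh ℓ k)⁻¹) ^ (Γ.etaPow v : ℝ)) := by
  have hc := coef_nonneg Γ ℓ k he hl dv ds v
  have hkey := (W v).dcore_le (mesh_pos ℓ k).le μ x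
  rw [bdiffQ_apply]
  unfold uOf
  rw [← mul_sub, ← mul_assoc, mul_comm (mesh ℓ k), mul_assoc, abs_mul, abs_of_nonneg hc, abs_mul,
    abs_of_pos (mesh_pos ℓ k)]
  calc eRun ^ dv v * lamRun ^ ds v * ((mesh ℓ k)⁻¹) ^ (Γ.etaPow v : ℝ) * (mesh ℓ k * |(W v).core x - (W v).core (bsh μ x)|)
      ≤ eRun ^ dv v * lamRun ^ ds v * ((mesh ℓ k)⁻¹) ^ (Γ.etaPow v : ℝ) * ((1 + (W v).p + (W v).q) * ((W v).Φ.prodN * (W v).A.prodN)) :=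
        mul_le_mul_of_nonneg_left hkey hc
    _ = _ := by ring

/-- Face vanishing of the vertex function from that of `g_v`. [cite: Balaban1983Higgs3, (2.8) p.425] -/
theorem faceVanishing_uOf {L : ℕ} {C : Cube (d + 1)} {μ : Fin (d + 1)} (v : V) (h : FaceVanishing L C μ (W v).g) :
    FaceVanishing L C μ (uOf Γ ℓ k eRun lamRun dv ds W v) := fun x hx => by
  unfold uOf; rw [(W v).faceVanishing_core h x hx, mul_zero]

/-- **The vertex datum of a graph of the zero-field box class FROM LEGS**: vertex functions `uOf`, norms `N^Φ_v = ΠN_i`,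
`N^A_v = ΠN_j`, the constant of the differentiated vertex bound `c_D = 1 + max_v(p_v + q_v)`; at the vertices carrying a derivative
leg the localization function is required to vanish on the faces of `□(v)` transversal to its direction (the support condition
of the summation by parts (2.8)). Every field of `VertexDataIBP` is PROVED. [cite: Balaban1983Higgs3, (2.8) p.425, (2.13) p.426] -/
def vertexDataOfLegs (box : V → Fin (d + 1) → ℕ) (eRun lamRun : ℝ) (he : 0 ≤ eRun) (hl : 0 ≤ lamRun)
    (hface : ∀ v, Γ.der v ≠ none → FaceVanishing (ℓ + 1) (⟨k, box v⟩ : Cube (d + 1)) (Γ.dir v) (W v).g) :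
    VertexDataIBP Γ ℓ k box where
  u := uOf Γ ℓ k eRun lamRun dv ds W
  eRun := eRun
  lamRun := lamRun
  dv := dv
  ds := ds
  NPhi := fun v => (W v).Φ.prodN
  NA := fun v => (W v).A.prodN
  eRun_nonneg := he
  lamRun_nonneg := hl
  NPhi_nonneg := fun v => (W v).Φ.prodN_nonneg
  NA_nonneg := fun v => (W v).A.prodN_nonneg
  u_le := fun v x => abs_uOf_le Γ ℓ k he hl dv ds W v x
  cD := 1 + ((univ.sup fun v => (W v).p + (W v).q : ℕ) : ℝ)
  one_le_cD := le_add_of_nonneg_right (Nat.cast_nonneg _)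
  u_face := fun v hv => faceVanishing_uOf Γ ℓ k dv ds W v (hface v hv)
  du_le := fun v _ x => by
    have hsv : (W v).p + (W v).q ≤ univ.sup fun w => (W w).p + (W w).q :=
      Finset.le_sup (f := fun w => (W w).p + (W w).q) (mem_univ v)
    have hsum : (1 + (W v).p + (W v).q : ℝ) ≤ 1 + ((univ.sup fun w => (W w).p + (W w).q : ℕ) : ℝ) := by
      have := (Nat.cast_le (α := ℝ)).2 hsv; push_cast at this; linarith
    have hB : 0 ≤ eRun ^ dv v * lamRun ^ ds v * (W v).Φ.prodN * (W v).A.prodN * ((mesh ℓ k)⁻¹) ^ (Γ.etaPow v : ℝ) :=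
      mul_nonneg (mul_nonneg (mul_nonneg (mul_nonneg (pow_nonneg he _) (pow_nonneg hl _)) (W v).Φ.prodN_nonneg)
        (W v).A.prodN_nonneg) (Real.rpow_nonneg (inv_nonneg.2 (mesh_pos ℓ k).le) _)
    exact (duOf_le Γ ℓ k he hl dv ds W v (Γ.dir v) x).trans (mul_le_mul_of_nonneg_right hsum hB)

/-- The constant of the datum from legs. [cite: Balaban1983Higgs3, (2.8) p.425] -/
theorem vertexDataOfLegs_cD (box : V → Fin (d + 1) → ℕ) (eRun lamRun : ℝ) (he : 0 ≤ eRun) (hl : 0 ≤ lamRun)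
    (hface : ∀ v, Γ.der v ≠ none → FaceVanishing (ℓ + 1) (⟨k, box v⟩ : Cube (d + 1)) (Γ.dir v) (W v).g) :
    (vertexDataOfLegs Γ ℓ k dv ds W box eRun lamRun he hl hface).cD
      = 1 + ((univ.sup fun v => (W v).p + (W v).q : ℕ) : ℝ) := rfl

/-- The vertex functions of the datum from legs. [cite: Balaban1983Higgs3, (2.13) p.426] -/
theorem vertexDataOfLegs_u (box : V → Fin (d + 1) → ℕ) (eRun lamRun : ℝ) (he : 0 ≤ eRun) (hl : 0 ≤ lamRun)
    (hface : ∀ v, Γ.der v ≠ none → FaceVanishing (ℓ + 1) (⟨k, box v⟩ : Cube (d + 1)) (Γ.dir v) (W v).g) :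
    (vertexDataOfLegs Γ ℓ k dv ds W box eRun lamRun he hl hface).u = uOf Γ ℓ k eRun lamRun dv ds W := rfl

end OfLegs

/-! ## §5 A localization function: the tent -/

section Tent

variable (L : ℕ) (C : Cube (d + 1)) (μ : Fin (d + 1)) (s : ℝ)

/-- **A face-vanishing localization function with the two bounds** (a lattice partition-of-unity profile, p. 420 *"with supports
in cubes"*): the tent `g(x) = s^{-1}·min(x_μ − lo_μ − 1, hi_μ − 2 − x_μ)₊` across the cube in the direction `μ`, for `s ≥ hi_μ − lo_μ`
(`s = η^{-1} = L^k` for a unit cube of the scale `k`). [cite: Balaban1983Higgs3, p.420, (2.8) p.425] -/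
def tent (x : Fin (d + 1) → ℕ) : ℝ :=
  s⁻¹ * min (((x μ : ℝ) - C.lo L μ - 1)) ((C.hi L μ : ℝ) - 2 - x μ) ⊔ 0

/-- The tent vanishes on (and outside) the two `μ`-faces. [cite: Balaban1983Higgs3, (2.8) p.425] -/
theorem tent_faceVanishing (hs : 0 ≤ s) : FaceVanishing L C μ (tent L C μ s) := fun x hx => by
  unfold tent
  refine sup_eq_right.2 (mul_nonpos_iff.2 (Or.inl ⟨inv_nonneg.2 hs, ?_⟩))
  rcases hx with h | h
  · exact min_le_of_left_le (by have := (Nat.cast_le (α := ℝ)).2 h; linarith)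
  · exact min_le_of_right_le (by have := (Nat.cast_le (α := ℝ)).2 h; push_cast at this; linarith)

/-- `0 ≤ tent`. [cite: Balaban1983Higgs3, (2.8) p.425] -/
theorem tent_nonneg (x : Fin (d + 1) → ℕ) : 0 ≤ tent L C μ s x := le_sup_right

/-- `|tent| ≤ 1` when `s ≥ hi_μ − lo_μ`. [cite: Balaban1983Higgs3, (2.13) p.426] -/
theorem abs_tent_le (hs : 0 < s) (hside : ((C.hi L μ : ℝ)) - C.lo L μ ≤ s) (x : Fin (d + 1) → ℕ) : |tent L C μ s x| ≤ 1 := by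
  rw [abs_of_nonneg (tent_nonneg L C μ s x)]
  unfold tent
  refine sup_le ?_ zero_le_one
  rw [inv_mul_le_iff₀ hs, mul_one]
  by_cases h : ((x μ : ℝ) - C.lo L μ - 1) ≤ ((C.hi L μ : ℝ) - 2 - x μ)
  · rw [min_eq_left h]; linarith
  · rw [min_eq_right (not_le.1 h).le]; linarith

/-- The unit-scale Lipschitz bound of the tent: `s|tent(x) − tent(x − e_ν)| ≤ 1` in every direction. [cite: Balaban1983Higgs3, (2.8) p.425] -/
theorem dtent_le (hs : 0 < s) (ν : Fin (d + 1)) (x : Fin (d + 1) → ℕ) :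
    s * |tent L C μ s x - tent L C μ s (bsh ν x)| ≤ 1 := by
  have hcoord : ((bsh ν x μ : ℕ) : ℝ) = x μ ∨ ((bsh ν x μ : ℕ) : ℝ) = x μ - 1 := by
    by_cases hν : μ = ν
    · subst hν
      rw [bsh_apply_same]
      rcases Nat.eq_zero_or_pos (x μ) with h0 | hpos
      · left; simp [h0]
      · right; rw [Nat.cast_sub hpos, Nat.cast_one]
    · left; rw [bsh_apply_of_ne hν]
  -- the tent is `s⁻¹`-Lipschitz in the real variable `x_μ`
  have hlip : ∀ a b : ℝ, |(s⁻¹ * min (a - C.lo L μ - 1) ((C.hi L μ : ℝ) - 2 - a) ⊔ 0)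
      - (s⁻¹ * min (b - C.lo L μ - 1) ((C.hi L μ : ℝ) - 2 - b) ⊔ 0)| ≤ s⁻¹ * |a - b| := by
    intro a b
    have hmin : |min (a - C.lo L μ - 1) ((C.hi L μ : ℝ) - 2 - a) - min (b - C.lo L μ - 1) ((C.hi L μ : ℝ) - 2 - b)| ≤ |a - b| := by
      have := abs_min_sub_min_le_max (a - C.lo L μ - 1) ((C.hi L μ : ℝ) - 2 - a) (b - C.lo L μ - 1) ((C.hi L μ : ℝ) - 2 - b)
      refine this.trans (max_le ?_ ?_)
      · exact le_of_eq (by ring_nf)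
      · rw [show (C.hi L μ : ℝ) - 2 - a - ((C.hi L μ : ℝ) - 2 - b) = -(a - b) by ring, abs_neg]
    calc |(s⁻¹ * min (a - C.lo L μ - 1) ((C.hi L μ : ℝ) - 2 - a) ⊔ 0) - (s⁻¹ * min (b - C.lo L μ - 1) ((C.hi L μ : ℝ) - 2 - b) ⊔ 0)|
        ≤ |s⁻¹ * min (a - C.lo L μ - 1) ((C.hi L μ : ℝ) - 2 - a) - s⁻¹ * min (b - C.lo L μ - 1) ((C.hi L μ : ℝ) - 2 - b)| :=
          abs_max_sub_max_le_abs _ _ _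
      _ = s⁻¹ * |min (a - C.lo L μ - 1) ((C.hi L μ : ℝ) - 2 - a) - min (b - C.lo L μ - 1) ((C.hi L μ : ℝ) - 2 - b)| := by
          rw [← mul_sub, abs_mul, abs_of_pos (inv_pos.2 hs)]
      _ ≤ s⁻¹ * |a - b| := mul_le_mul_of_nonneg_left hmin (inv_pos.2 hs).le
  have h := hlip (x μ) (bsh ν x μ)
  unfold tent
  have hab : |((x μ : ℕ) : ℝ) - ((bsh ν x μ : ℕ) : ℝ)| ≤ 1 := by
    rcases hcoord with hc | hc <;> rw [hc] <;> norm_num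
  calc s * |(s⁻¹ * min (((x μ : ℝ) - C.lo L μ - 1)) ((C.hi L μ : ℝ) - 2 - x μ) ⊔ 0)
        - (s⁻¹ * min ((((bsh ν x μ : ℕ) : ℝ) - C.lo L μ - 1)) ((C.hi L μ : ℝ) - 2 - (bsh ν x μ : ℕ)) ⊔ 0)|
      ≤ s * (s⁻¹ * |((x μ : ℕ) : ℝ) - ((bsh ν x μ : ℕ) : ℝ)|) := mul_le_mul_of_nonneg_left h hs.le
    _ = |((x μ : ℕ) : ℝ) - ((bsh ν x μ : ℕ) : ℝ)| := by rw [← mul_assoc, mul_inv_cancel₀ hs.ne', one_mul]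
    _ ≤ 1 := hab

/-- **Non-vacuity with a genuine localization function**: legs given, the tent across the unit cube `□(v)` of the scale `k`
(mesh `s = L^k` = the side of `□(v)` in lattice points) completes them to vertex data with `|g| ≤ 1`, `|∂g| ≤ 1`, face vanishing
in the direction `μ`. [cite: Balaban1983Higgs3, (2.8) p.425, (2.13) p.426] -/
def vertexLegsTent (ℓ k : ℕ) {p q : ℕ} (Φ : Legs d p (mesh ℓ k)) (A : Legs d q (mesh ℓ k)) (z : Fin (d + 1) → ℕ)
    (μ : Fin (d + 1)) : VertexLegs d (mesh ℓ k) where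
  p := p
  q := q
  Φ := Φ
  A := A
  g := tent (ℓ + 1) ⟨k, z⟩ μ (mesh ℓ k)
  g_le := abs_tent_le (ℓ + 1) ⟨k, z⟩ μ (mesh ℓ k) (mesh_pos ℓ k) (by
    unfold Cube.hi Cube.lo mesh; push_cast; nlinarith [pow_nonneg (show (0 : ℝ) ≤ (ℓ + 1 : ℕ) by positivity) k])
  dg_le := dtent_le (ℓ + 1) ⟨k, z⟩ μ (mesh ℓ k) (mesh_pos ℓ k)

/-- Its localization function vanishes on the `μ`-faces of the cube `⟨k, z⟩`. [cite: Balaban1983Higgs3, (2.8) p.425] -/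
theorem vertexLegsTent_face (ℓ k : ℕ) {p q : ℕ} (Φ : Legs d p (mesh ℓ k)) (A : Legs d q (mesh ℓ k)) (z : Fin (d + 1) → ℕ)
    (μ : Fin (d + 1)) : FaceVanishing (ℓ + 1) (⟨k, z⟩ : Cube (d + 1)) μ (vertexLegsTent ℓ k Φ A z μ).g :=
  tent_faceVanishing (ℓ + 1) ⟨k, z⟩ μ (mesh ℓ k) (mesh_pos ℓ k).le

/-- Constant legs (`f_i ≡ c_i`, `N_i = |c_i|`): the leg type is inhabited for every mesh. [cite: Balaban1983Higgs3, (1.32) p.420] -/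
def Legs.const {p : ℕ} (s : ℝ) (c : Fin p → ℝ) : Legs d p s where
  f := fun i _ => c i
  N := fun i => |c i|
  f_le := fun _ _ => le_rfl
  df_le := fun i _ _ => by rw [sub_self, abs_zero, mul_zero]; exact abs_nonneg _

/-- **The vertex datum of any graph of the class from legs and tents**: at every vertex the given legs and the tent across `□(v)`
in the direction of its derivative leg — a `VertexDataIBP` with every field PROVED and non-zero localization functions.
[cite: Balaban1983Higgs3, (2.8) p.425, (2.13) p.426] -/
def vertexDataTent {V : Type} [Fintype V] [DecidableEq V] {m : ℕ} (Γ : SDGraph V m d) (ℓ k : ℕ)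
    (box : V → Fin (d + 1) → ℕ) (eRun lamRun : ℝ) (he : 0 ≤ eRun) (hl : 0 ≤ lamRun) (dv ds : V → ℕ) {p q : V → ℕ}
    (Φ : ∀ v, Legs d (p v) (mesh ℓ k)) (A : ∀ v, Legs d (q v) (mesh ℓ k)) : VertexDataIBP Γ ℓ k box :=
  vertexDataOfLegs Γ ℓ k dv ds (fun v => vertexLegsTent ℓ k (Φ v) (A v) (box v) (Γ.dir v)) box eRun lamRun he hl
    fun v _ => vertexLegsTent_face ℓ k (Φ v) (A v) (box v) (Γ.dir v)

end Tent

/-! ## §6 Data of the family `famZB` with vertex functions from legs -/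

section Family

variable (P : ParamsZB) (k : ℕ)

/-- **External legs for every graph of the class** at the scale `k`: per graph and vertex, the orders `d_v(v)`, `d_s(v)`, the
scalar and vector legs (sup and difference bounds at mesh `η^{-1} = L^k`), with the numbers of legs per vertex bounded by `pmax` and
`1 + pmax ≤ C_D` (the vertices of [B3] have boundedly many legs, p. 428). [cite: Balaban1983Higgs3, (2.13) p.426, Prop. 2.2 p.428] -/
structure LegField where
  /-- bound on the number of external legs of a vertex -/
  pmax : ℕ
  /-- `d_v(v)` -/
  dv : ∀ {n m : ℕ}, SDGraph (Fin n) m P.d → Fin n → ℕ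
  /-- `d_s(v)` -/
  ds : ∀ {n m : ℕ}, SDGraph (Fin n) m P.d → Fin n → ℕ
  /-- number of scalar legs of `v` -/
  p : ∀ {n m : ℕ}, SDGraph (Fin n) m P.d → Fin n → ℕ
  /-- number of vector legs of `v` -/
  q : ∀ {n m : ℕ}, SDGraph (Fin n) m P.d → Fin n → ℕ
  /-- the scalar legs -/
  Φ : ∀ {n m : ℕ} (Γ : SDGraph (Fin n) m P.d) (v : Fin n), Legs P.d (p Γ v) (mesh P.ℓ k)
  /-- the vector legs -/
  A : ∀ {n m : ℕ} (Γ : SDGraph (Fin n) m P.d) (v : Fin n), Legs P.d (q Γ v) (mesh P.ℓ k)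
  legs_le : ∀ {n m : ℕ} (Γ : SDGraph (Fin n) m P.d) (v : Fin n), p Γ v + q Γ v ≤ pmax
  hCD : 1 + (pmax : ℝ) ≤ P.CD

variable {P k}

/-- **A datum of the family with vertex functions from legs**: the scale, window point, box and couplings of `D`, and at every
graph and localization the vertex datum `vertexDataTent` of the legs `F` (tents across the cubes `□(v)` in the directions of the
derivative legs). [cite: Balaban1983Higgs3, Prop. 2.1 p.424, (2.13) p.426] -/
def datumWithLegs (D : DatumZB P) (F : LegField P D.k) : DatumZB P where
  k := D.k
  hk := D.hk
  a := D.a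
  m2 := D.m2
  h1 := D.h1
  h2 := D.h2
  h3 := D.h3
  h4 := D.h4
  M := D.M
  hM := D.hM
  eRun := D.eRun
  lamRun := D.lamRun
  eRun_pos := D.eRun_pos
  lamRun_pos := D.lamRun_pos
  vtx := fun Γ box => vertexDataTent Γ P.ℓ D.k box D.eRun D.lamRun D.eRun_pos.le D.lamRun_pos.le (F.dv Γ) (F.ds Γ) (F.Φ Γ) (F.A Γ)
  vtx_eRun := fun _ _ => rfl
  vtx_lamRun := fun _ _ => rfl
  vtx_dv := fun _ _ _ => rfl
  vtx_ds := fun _ _ _ => rfl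
  vtx_cD_le := fun Γ _ => by
    show 1 + ((univ.sup fun v => F.p Γ v + F.q Γ v : ℕ) : ℝ) ≤ P.CD
    have hsup : (univ.sup fun v => F.p Γ v + F.q Γ v) ≤ F.pmax := Finset.sup_le fun v _ => F.legs_le Γ v
    have := (Nat.cast_le (α := ℝ)).2 hsup
    linarith [F.hCD]

/-- Its vertex functions ARE the leg products with tents: `u_v = e^{d_v}λ^{d_s}η^{e_v}·tent_{□(v)}·ΠΦ_i·ΠA_j`.
[cite: Balaban1983Higgs3, (2.13) p.426] -/
theorem datumWithLegs_u (D : DatumZB P) (F : LegField P D.k) {n m : ℕ} (Γ : SDGraph (Fin n) m P.d)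
    (box : Fin n → Fin (P.d + 1) → ℕ) :
    ((datumWithLegs D F).vtx Γ box).u
      = uOf Γ P.ℓ D.k D.eRun D.lamRun (F.dv Γ) (F.ds Γ) (fun v => vertexLegsTent P.ℓ D.k (F.Φ Γ v) (F.A Γ v) (box v) (Γ.dir v)) :=
  rfl

/-- **(1.33) for the zero-field box class with vertex functions from legs** — `prop21_zeroBox` at these data: for every graph of
the expansion satisfying the printed hypothesis of Proposition 2.1 and every localization, with ONE `O(1)` per `n̄`.
[cite: Balaban1983Higgs3, Prop. 2.1 p.424, (1.33) p.420] -/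
theorem ineq133At_withLegs (mbar : ℕ → ℕ) :
    ∃ δ₀ : ℝ, 0 < δ₀ ∧ ∀ α₀ : ℝ, 0 < α₀ → α₀ < 1 → ∀ nbar : ℕ, ∃ C : ℝ, 0 < C ∧
      ∀ (D : DatumZB P) (F : LegField P D.k) (G : CGraphZB P (mbar nbar)),
        B3Prop1.PosSubgraphsExcept24 (expansionZB P (mbar nbar) (datumWithLegs D F)) G →
          B3Prop1.Ineq133At (famZB P mbar nbar (datumWithLegs D F)).toExpansion G α₀ δ₀ C := by
  obtain ⟨δ₀, hδ, H⟩ := prop21_zeroBox P mbar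
  refine ⟨δ₀, hδ, fun α₀ h0 h1 nbar => ?_⟩
  obtain ⟨C, hC, HC⟩ := H α₀ h0 h1 nbar
  exact ⟨C, hC, fun D F G hG => HC (datumWithLegs D F) G hG⟩

end Family

end

end Literature.MathematicalPhysics.QuantumFieldTheory.Balaban1983to89.B3IBPZeroBoxVertices
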